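import Summits.BirchSwinnertonDyer.BirchSwinnertonDyer.Theorems.ResidualThetaTransportAtTwoResidualSignedLambdaLowerCMAtTwoRelaxedDeepHalf
import Summits.BirchSwinnertonDyer.BirchSwinnertonDyer.Theorems.ResidualThetaTransportAtTwoAwayDefs
import Summits.BirchSwinnertonDyer.BirchSwinnertonDyer.Theorems.ResidualThetaTransportAtTwoResidualSignedLambdaLowerCMAtTwoDeepHalfAwayTwoCharacterReadback
import Summits.BirchSwinnertonDyer.BirchSwinnertonDyer.Theorems.AlignedTransportAtTwoMainConjectureOfRankZeroBSDAtTwoFineRoadCokerAtTwo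
import Literature.NumberTheory.EllipticCurves.H1CorestrictionIndexTwo
import Literature.Algebra.InverseSystem.PadicIntLift
import HarnessLib

/-!
# stub-ideation k1·g19 — `stub_cmLambdaLower` (= RSL_g `ResidualSignedLambdaLowerCMAtTwo`), technique «weaken / strengthen»

Sketch for the idea card `Cruxes/ResidualThetaCountLowerPureAtTwo/Ideas/stub_cmLambdaLower-k1.md` (slug `stub-cmlambdalower-k1-g19`).
Crux `ResidualThetaCountLowerPureAtTwo` (stmt-BirchSwinnertonDyer-26074), route `ResidualThetaTransportAtTwo`, skeleton `Lines/bt26_lambda.lean` v7,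
line of record `onepair` v3d.  **BSD is NOT proved by any of this; RSL_g is not proved here; nothing below is a Theorems proposal.**

WHAT IS HERE (everything PROVED, nothing admitted; §C states two typed TARGET PROPOSITIONS as `def … : Prop`, not as theorems):
* §A CONSUMER SIDE (pure module algebra over the landed consumer `CharIdealLambda.deepHalfSigma_of_relaxed`, p-RelaxedDeepHalf):
  - `deepHalfSigma_of_relaxed_of_imp` — the binder `hSg : s ∈ Sg ↔ loc₂ s ∈ E⁺` is WEAKENED to the single implication
    `loc₂ s ∈ E⁺ → s ∈ Sg` (the consumer uses only `(hSg s).mpr`): same conclusion.  WEAKEST SUFFICIENT FORM of T1 (d).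
  - `le_finrank_of_relaxedDuality_decorated_of_imp` — the decorated consumer with the same weakening.
  - `hπker_of_generators` — `hπker` for `E⁺` follows from `hπker` on ANY subset `G ⊆ E⁺` (so `E⁺` enters (e) only through generators and
    (d) only through `loc₂⁻¹`): the design tension «(d) wants `E⁺` small, (e) wants `E⁺` big» is one-sided.
* §B SUPPLY SIDE, in the EXACT currency of the pins `OnePairPins` / `AtTwoPins` (p698991):
  - `toZModPow_eq_of_levelValue_eq`, `padicInt_eq_of_forall_levelValue_eq` — the value currency separates `ℤ₂` 2-adically.
  - `col_comp_single_eq_zero_of_c₂_vanish` — **T1 (e) `hπker` DISCHARGED** against `π.col_eq_zero_iff` from ONE existence hypothesis: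
    `E⁺` contains, for every layer-plus point `x`, coordinate `i` and level `k`, a class whose `c₂`-values are the level-`k` values at `x·e_i`
    (the single-coordinate plus Kummer classes).  WEAKEST SUFFICIENT FORM of (e).
  - `c₂_injective_of_kummerClasses` — injectivity of `c₂` is FREE from the same kind of classes (STRONGEST PROVABLE FORM of PERF₂: bijection).
  - `c₂_surjective_of_kummerFamily` — **PERF₂ (T1 (c)) REDUCED to a coherent Kummer-class family** `δ k : E(ℚ_{∞,v})ⁿ →+ D₂`
    (`δ 0 = 0`, `2·δ_{k+1} = δ_k`, exhaustive, value-pinned): the complete ALGEBRA of local Tate duality in the value currency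
    (`exists_zmodHom_of_nsmul_eq_zero` per level + `padicIntLift`), leaving only the ARITHMETIC «the Kummer map on the tower is such a family».
* §C THE (⇐) DIRECTION OF `hSg` IS Γ-STABILITY, NOT COCYCLE TRANSFER ALONE:
  - `PlusClauseAt` — clause (3) of RSL_g at `(v, hv)` for ONE class, verbatim;  RSL_g's clause (3) for `y` is `∀ v hv σ, PlusClauseAt v hv (conj_σ y)`.
  - `forall_conjH1_iff_of_transport` — GENERIC one-orbit reduction (pattern of `CokerAtTwo.forall_conjH1_mem_awayKer_iff`, arbitrary predicate).
  - `PlusTransport` (typed TARGET, `Prop`) — the `D_v`-transport of a plus Θ-Kummer datum under `conjCocycle` (tower twin of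
    `CofreeSelmerTransfer.thetaKummerWitness_conj` + `Γ_v`-stability of `⨆_m E⁺_m`), the ONE new helper of the (⇐) direction.
  - `forall_plusClauseAt_conjH1_iff` — PROVED: `PlusTransport` + `Γ_ℚ = θ_v(Γ_{ℚ_v})·Γ_∞` ⟹ (clause (3) for all `σ` ⟺ clause (3) at `σ = 1`);
    `forall_plusClauseAt_conjH1_iff_two` — the instance at the place above `2` (κ cyclotomic: `CokerAtTwo.exists_mem_decomp_inv_mul_mem_kerSubgroup_two`).

STATUS AT FILING (2026-08-29 ≈07:50Z — the lane moved while this sketch was written; recorded so that NO seat re-derives or ports what follows):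
* T1 (c) PERF₂ is LANDED as `ThetaTransport.AtTwoPackage.surjective_of_valuePin` (w2 g20, `…AtTwoPerfect.lean`, 07:16Z): `c₂_surjective_of_kummerFamily`
  below is an ALTERNATIVE algebraic reduction of the same statement (family `δ` + `padicIntLift` instead of divisible-hull descent) — NOT a port target.
* T1 (d)(e) are LANDED as `ThetaTransport.AtTwoPackage.exists_Eplus` (p704499, `…AtTwoPlus.lean`, both directions of `hSg` and `hπker`):
  `col_comp_single_eq_zero_of_c₂_vanish` is the generator-form twin of its second clause; §C's `PlusTransport` is the typed form of the internal
  (←)-step of its first clause.  What remains USABLE from here: §A (the consumer needs only `(hSg s).mpr` and `hπker` on generators — a robustness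
  margin for the LEAD's `onePairSupply_of_packages`), `c₂_injective_of_kummerClasses` (PERF₂ is a bijection), and the generic one-orbit lemma
  `forall_conjH1_iff_of_transport` (any predicate, any place; reusable by the EH / S4₀ lanes when a `∀ σ` binder must be read at one representative).
-/

set_option autoImplicit false
set_option linter.dupNamespace false

noncomputable section

open scoped TensorProduct Classical

namespace Summit.BirchSwinnertonDyer.BirchSwinnertonDyer.Cruxes.ResidualThetaCountLowerPureAtTwo.SideaK1G19

universe u v w

/-! ## §A Consumer side: the weakest sufficient forms of T1 (d) `hSg` and T1 (e) `hπker` -/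

section Consumer

open Summit.BirchSwinnertonDyer.BirchSwinnertonDyer.Theorems Summit.BirchSwinnertonDyer.BirchSwinnertonDyer.Theorems.CharIdealLambda

variable {A : Type u} [CommRing A]
  {P₀ : Type v} [AddCommGroup P₀] [Module A P₀]
  {PS : Type v} [AddCommGroup PS] [Module A PS]
  {D₂ : Type v} [AddCommGroup D₂] [Module A D₂]
  {DS : Type v} [AddCommGroup DS] [Module A DS]
  {P : Type v} [AddCommGroup P] [Module A P]
  {H : Type v} [AddCommGroup H] [Module A H]
  {SelRel : Type v} [AddCommGroup SelRel] [Module A SelRel]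

/-- **`deepHalfSigma_of_relaxed` with ONE-DIRECTIONAL `hSg`.**  The landed consumer uses its binder `hSg : s ∈ Sg ↔ loc₂ s ∈ E⁺` only
right-to-left; here it is weakened to `loc₂ s ∈ E⁺ → s ∈ Sg`.  Proof: run the landed theorem on the honest preimage `Sg₀ := loc₂⁻¹(E⁺) ≤ Sg`
with the restricted pairing `pair₀ := pair|_{Sg₀}`; `pair z = 0 ⇒ pair₀ z = 0`. [cite: MilneADT2006, Ch. I, Cor. 2.3] -/
theorem deepHalfSigma_of_relaxed_of_imp
    (c₂ : P₀ →ₗ[A] CharacterModule D₂) (cS : PS →ₗ[A] CharacterModule DS) (hsurj : Function.Surjective c₂)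
    (loc₂ : SelRel →ₗ[A] D₂) (locS : SelRel →ₗ[A] DS) (Eplus : Submodule A D₂)
    (Sg : Submodule A SelRel) (hSg : ∀ s, loc₂ s ∈ Eplus → s ∈ Sg)
    (π : (P₀ × PS) →ₗ[A] P) (hπ : Function.Surjective π)
    (hπker : ∀ h₂ : P₀, (∀ e ∈ Eplus, c₂ h₂ e = 0) → π (h₂, 0) = 0)
    (pair : P →ₗ[A] CharacterModule Sg)
    (hcompat : ∀ (t : P₀ × PS) (s : Sg), pair (π t) s = c₂ t.1 (loc₂ s) + cS t.2 (locS s))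
    (loc' : H →ₗ[A] P₀ × PS) (locd : H →ₗ[A] P) (hloc : ∀ x, locd x = π (loc' x))
    (hDHrel : ∀ t : P₀ × PS, (∀ s : SelRel, c₂ t.1 (loc₂ s) + cS t.2 (locS s) = 0) →
      ∃ a : A, a ≠ 0 ∧ ∃ x : H, a • t = loc' x) :
    ∀ z : P, pair z = 0 → ∃ a : A, a ≠ 0 ∧ ∃ x : H, a • z = locd x := by
  intro z hz
  let Sg₀ : Submodule A SelRel := Eplus.comap loc₂
  have hle : Sg₀ ≤ Sg := fun s hs ↦ hSg s hs
  let pair₀ : P →ₗ[A] CharacterModule Sg₀ := CharacterModule.dual (Submodule.inclusion hle) ∘ₗ pair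
  have hcompat₀ : ∀ (t : P₀ × PS) (s : Sg₀), pair₀ (π t) s = c₂ t.1 (loc₂ s) + cS t.2 (locS s) :=
    fun t s ↦ hcompat t (Submodule.inclusion hle s)
  have hz₀ : pair₀ z = 0 := by
    show CharacterModule.dual (Submodule.inclusion hle) (pair z) = 0
    rw [hz, map_zero]
  exact deepHalfSigma_of_relaxed c₂ cS hsurj loc₂ locS Eplus Sg₀ (fun _ ↦ Iff.rfl) π hπ hπker pair₀ hcompat₀
    loc' locd hloc hDHrel z hz₀

/-- **`hπker` sees `E⁺` only through a generating subset**: if `hπker` holds with `E⁺` replaced by any `G ⊆ E⁺`, it holds for `E⁺`.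
Together with `deepHalfSigma_of_relaxed_of_imp` (which sees `E⁺` only through `loc₂⁻¹(E⁺) ⊆ Sg`) this makes the design space of T1 (d)(e)
explicit: any `E⁺` between «the test classes (e) needs» and «the classes whose preimage lies in `Sg`» works. [folklore] -/
theorem hπker_of_generators (c₂ : P₀ →ₗ[A] CharacterModule D₂) (π : (P₀ × PS) →ₗ[A] P)
    {G : Set D₂} {Eplus : Submodule A D₂} (hG : G ⊆ Eplus)
    (hgen : ∀ h₂ : P₀, (∀ g ∈ G, c₂ h₂ g = 0) → π (h₂, 0) = 0) :
    ∀ h₂ : P₀, (∀ e ∈ Eplus, c₂ h₂ e = 0) → π (h₂, 0) = 0 :=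
  fun h₂ h ↦ hgen h₂ fun g hg ↦ h g (hG hg)

variable (K : Type w) [Field K] [Algebra A K] [IsFractionRing A K]

/-- **The decorated consumer `d ≤ λ(Sg⋆)` with ONE-DIRECTIONAL `hSg`** (= `le_finrank_baseChange_characterModule_of_relaxedDuality_decorated`
with `hSg` weakened to `loc₂ s ∈ E⁺ → s ∈ Sg`; every other binder verbatim).  Closes nothing. [cite: Kobayashi2003, Thm. 7.3 ((7.17)–(7.21))]
[cite: MilneADT2006, Ch. I, Thm. 4.10 (b)] -/
theorem le_finrank_of_relaxedDuality_decorated_of_imp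
    (c₂ : P₀ →ₗ[A] CharacterModule D₂) (cS : PS →ₗ[A] CharacterModule DS) (hsurj : Function.Surjective c₂)
    (loc₂ : SelRel →ₗ[A] D₂) (locS : SelRel →ₗ[A] DS) (Eplus : Submodule A D₂)
    (Sg : Submodule A SelRel) (hSg : ∀ s, loc₂ s ∈ Eplus → s ∈ Sg)
    (π : (P₀ × PS) →ₗ[A] P) (hπ : Function.Surjective π)
    (hπker : ∀ h₂ : P₀, (∀ e ∈ Eplus, c₂ h₂ e = 0) → π (h₂, 0) = 0)
    (pair : P →ₗ[A] CharacterModule Sg)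
    (hcompat : ∀ (t : P₀ × PS) (s : Sg), pair (π t) s = c₂ t.1 (loc₂ s) + cS t.2 (locS s))
    (loc' : H →ₗ[A] P₀ × PS) (locd : H →ₗ[A] P) (hloc : ∀ x, locd x = π (loc' x))
    (hDHrel : ∀ t : P₀ × PS, (∀ s : SelRel, c₂ t.1 (loc₂ s) + cS t.2 (locS s) = 0) →
      ∃ a : A, a ≠ 0 ∧ ∃ x : H, a • t = loc' x)
    (Z : Submodule A H) (Sel₀ : Submodule A Sg) {H2 : Type v} [AddCommGroup H2] [Module A H2]
    (hEH : ∀ z ∈ Z, pair (locd z) = 0) (horth : ∀ s ∈ Sel₀, ∀ z : P, pair z s = 0)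
    [Module.Finite K (K ⊗[A] (H ⧸ Z))] [Module.Finite K (K ⊗[A] (P ⧸ Z.map locd))]
    [Module.Finite K (K ⊗[A] CharacterModule Sg)] {d e : ℕ}
    (hi : d + e ≤ Module.finrank K (K ⊗[A] (P ⧸ Z.map locd)))
    (hii : Module.finrank K (K ⊗[A] (H ⧸ Z)) ≤ Module.finrank K (K ⊗[A] H2) + e)
    (hPT : Module.finrank K (K ⊗[A] H2) ≤ Module.finrank K (K ⊗[A] CharacterModule Sel₀)) :
    d ≤ Module.finrank K (K ⊗[A] CharacterModule Sg) :=
  CharIdealLambda.le_finrank_baseChange_characterModule_of_duality_decorated K pair locd Z Sel₀ hEH horth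
    (deepHalfSigma_of_relaxed_of_imp c₂ cS hsurj loc₂ locS Eplus Sg hSg π hπ hπker pair hcompat loc' locd hloc hDHrel) hi hii hPT

end Consumer

/-! ## §B Supply side, in the currency of `OnePairPins π` / `AtTwoPins π₂` -/

section Pins

open Summit.BirchSwinnertonDyer.BirchSwinnertonDyer.Theorems Summit.BirchSwinnertonDyer.BirchSwinnertonDyer.Theorems.OnePair
open Literature.NumberTheory.EllipticCurves Literature.NumberTheory.EllipticCurves.GreenbergSelmer
open Literature.NumberTheory.GaloisRepresentations NumberField IsDedekindDomain Field
open GreenbergSelmer Kobayashi2003 Literature.NumberTheory.EllipticCurves.CyclotomicLayer CategoryTheory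
open Summit.BirchSwinnertonDyer.BirchSwinnertonDyer.Theorems.ThetaTransport.AwayCharacterReadback

/-- **The value currency separates residues**: equal level-`k` values `(x mod 2^k)·2^{-k} = (y mod 2^k)·2^{-k} ∈ ℚ/ℤ` force `x ≡ y (mod 2^k)`
(`AwayCharacterReadback.zmod_eq_of_val_smul_eq` in the `(2:ℚ)^k` spelling of the pins). [cite: Kato2004Asterisque, §17.13 (p. 279)] -/
theorem toZModPow_eq_of_levelValue_eq (k : ℕ) {x y : ℤ_[2]}
    (h : (PadicInt.toZModPow k x).val • ((((2 : ℚ) ^ k)⁻¹ : ℚ) : AddCircle (1 : ℚ)) =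
      (PadicInt.toZModPow k y).val • ((((2 : ℚ) ^ k)⁻¹ : ℚ) : AddCircle (1 : ℚ))) :
    PadicInt.toZModPow k x = PadicInt.toZModPow k y := by
  haveI : NeZero (2 ^ k) := ⟨pow_ne_zero k two_ne_zero⟩
  rw [← inv_natCast_two_pow] at h
  exact zmod_eq_of_val_smul_eq h

/-- **2-adic separation**: equal level values at EVERY level force equality in `ℤ₂` (Mathlib `PadicInt.ext_of_toZModPow`). [folklore] -/
theorem padicInt_eq_of_forall_levelValue_eq {x y : ℤ_[2]}
    (h : ∀ k : ℕ, (PadicInt.toZModPow k x).val • ((((2 : ℚ) ^ k)⁻¹ : ℚ) : AddCircle (1 : ℚ)) =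
      (PadicInt.toZModPow k y).val • ((((2 : ℚ) ^ k)⁻¹ : ℚ) : AddCircle (1 : ℚ))) : x = y :=
  PadicInt.ext_of_toZModPow.1 fun k ↦ toZModPow_eq_of_levelValue_eq k (h k)

/-- `2^k · 2^{-k} = 0 ∈ ℚ/ℤ` in the pins' spelling. [folklore] -/
theorem two_pow_nsmul_inv_pow (k : ℕ) : (2 ^ k) • ((((2 : ℚ) ^ k)⁻¹ : ℚ) : AddCircle (1 : ℚ)) = 0 := by
  haveI : NeZero (2 ^ k) := ⟨pow_ne_zero k two_ne_zero⟩
  have h := addOrderOf_nsmul_eq_zero (((((2 ^ k : ℕ) : ℚ))⁻¹ : ℚ) : AddCircle (1 : ℚ))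
  rw [addOrderOf_inv_natCast] at h
  rwa [inv_natCast_two_pow] at h

/-- **Level change in the value currency**: reading a residue mod `2^(k+1)` at level `k` doubles the value,
`(a mod 2^k)·2^{-k} = 2·(a·2^{-(k+1)})`. [folklore] -/
theorem cast_val_smul_eq (k : ℕ) (a : ZMod (2 ^ (k + 1))) :
    (ZMod.cast a : ZMod (2 ^ k)).val • ((((2 : ℚ) ^ k)⁻¹ : ℚ) : AddCircle (1 : ℚ)) =
      2 • (a.val • ((((2 : ℚ) ^ (k + 1))⁻¹ : ℚ) : AddCircle (1 : ℚ))) := by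
  haveI : NeZero (2 ^ k) := ⟨pow_ne_zero k two_ne_zero⟩
  haveI : NeZero (2 ^ (k + 1)) := ⟨pow_ne_zero (k + 1) two_ne_zero⟩
  have h2u : 2 • ((((2 : ℚ) ^ (k + 1))⁻¹ : ℚ) : AddCircle (1 : ℚ)) = ((((2 : ℚ) ^ k)⁻¹ : ℚ) : AddCircle (1 : ℚ)) := by
    rw [← AddCircle.coe_nsmul]
    congr 1
    rw [nsmul_eq_mul, Nat.cast_ofNat, pow_succ, mul_inv, mul_comm (((2 : ℚ) ^ k)⁻¹) ((2 : ℚ)⁻¹), ← mul_assoc,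
      mul_inv_cancel₀ (two_ne_zero : (2 : ℚ) ≠ 0), one_mul]
  rw [← mul_smul, mul_comm, mul_smul, h2u, ZMod.cast_eq_val, ZMod.val_natCast]
  conv_rhs => rw [← Nat.div_add_mod a.val (2 ^ k), add_smul, mul_smul, smul_comm, two_pow_nsmul_inv_pow, smul_zero, zero_add]

variable (S : Set (PadicAlgCl 2)) (κ : ZpExtension ℚ 2) (ρ : FramedGaloisRep ℚ ↥(padicCoeffIntegers S) 2)
  (W : WeierstrassCurve ℚ) [W.IsElliptic] (n : ℕ)
  (Θ : ∀ v : HeightOneSpectrum (𝓞 ℚ), ((2 : ℕ) : 𝓞 ℚ) ∈ v.asIdeal → (Cofree ρ ↥(padicCoeffField S) ≃+ (Fin n → ↥(W.geomPrimaryTorsion 2))))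
  (S₀ : Finset (HeightOneSpectrum (𝓞 ℚ))) (γ : absoluteGaloisGroup ℚ)
  (hΘ : ∀ v hv (δ : absoluteGaloisGroup (v.adicCompletion ℚ)) m i,
    Θ v hv (resGalOfEmb (closureEmb (K := ℚ) (v.adicCompletion ℚ)) δ • m) i = resGalOfEmb (closureEmb (K := ℚ) (v.adicCompletion ℚ)) δ • Θ v hv m i)
  (I : Kato2004.IwasawaH1DataCoeff (FramedGaloisRep.toGaloisRep ρ) 2 κ γ)
  (Sg : AddSubgroup (subgroupH1 κ.kerSubgroup (Cofree ρ ↥(padicCoeffField S)))) [Module ↥(padicCoeffIntegers S) ↥Sg]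
  (π : OnePairPins S W κ γ S₀ n ρ Θ hΘ I Sg) [Module ℤ_[2] (Dloc S κ ρ π.v)]

variable {S κ ρ W n Θ S₀ γ hΘ I Sg π}

/-- **T1 (e) `hπker` DISCHARGED in the pins' currency, from ONE existence hypothesis.**  If `E⁺ ⊆ D₂` contains, for every layer-plus point
`x ∈ E⁺_m`, every coordinate `i` and every level `k`, a class whose `c₂`-values are the level-`k` values at the tuple `x·e_i`
(= the class of the plus Θ-Kummer datum `(Q := 2^{-k}x·e_i, k)`, via `AtTwoPins.hc₂`), then a functional `t ∈ 𝔉₂` with `c₂ t|_{E⁺} = 0`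
has `col (t ∘ single i) = 0` for every `i` — by 2-adic separation of the values and the kernel pin `π.col_eq_zero_iff` (Kobayashi's exact
sequence for the plus Coleman map). [cite: Kobayashi2003, Thm. 6.2 and (8.23) (p. 18)] -/
theorem col_comp_single_eq_zero_of_c₂_vanish (π₂ : AtTwoPins S κ ρ S₀ W γ n Θ hΘ I Sg π) (Eplus : Set (Dloc S κ ρ π.v))
    (hgen : ∀ (m : ℕ) (x : localPoints W (π.v.adicCompletion ℚ)) (hx : x ∈ signedLocalPoints κ (π.v.adicCompletion ℚ) W 1 m)
      (i : Fin n) (k : ℕ), ∃ y ∈ Eplus,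
        ∀ t : (Fin n → ↥(Sprung2012.localTowerPointsOfEmb κ (closureEmb (K := ℚ) (π.v.adicCompletion ℚ)) W)) →+ ℤ_[2],
          π₂.c₂ t y = (PadicInt.toZModPow k (t (Pi.single i ⟨x,
            Sprung2012.localLayerPointsOfEmb_le_localTowerPointsOfEmb κ (closureEmb (K := ℚ) (π.v.adicCompletion ℚ)) W m
              (signedLocalPointsOfEmb_le κ (closureEmb (K := ℚ) (π.v.adicCompletion ℚ)) W 1 m hx)⟩))).val •
            ((((2 : ℚ) ^ k)⁻¹ : ℚ) : AddCircle (1 : ℚ)))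
    (t : (Fin n → ↥(Sprung2012.localTowerPointsOfEmb κ (closureEmb (K := ℚ) (π.v.adicCompletion ℚ)) W)) →+ ℤ_[2])
    (ht : ∀ y ∈ Eplus, π₂.c₂ t y = 0) (i : Fin n) :
    π.col (t.comp (AddMonoidHom.single
      (fun _ : Fin n => ↥(Sprung2012.localTowerPointsOfEmb κ (closureEmb (K := ℚ) (π.v.adicCompletion ℚ)) W)) i)) = 0 := by
  rw [π.col_eq_zero_iff]
  intro m x hx
  rw [AddMonoidHom.comp_apply, AddMonoidHom.single_apply]
  refine PadicInt.ext_of_toZModPow.1 fun k ↦ ?_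
  obtain ⟨y, hy, hval⟩ := hgen m x hx i k
  apply toZModPow_eq_of_levelValue_eq
  rw [← hval t, ht y hy, map_zero, ZMod.val_zero, zero_smul]

/-- **Injectivity of `c₂` is FREE** (the STRONGEST PROVABLE form of PERF₂ is a bijection `𝔉₂ ≅ D₂⋆`): if for every tower tuple `P` and level
`k` some class has `c₂`-values the level-`k` values at `P` (the Kummer class `δ_k(P)`), then `c₂` is injective — values at every level
determine `t(P) ∈ ℤ₂`. [cite: PerrinRiou1994Invent, §3.6.1] -/
theorem c₂_injective_of_kummerClasses (π₂ : AtTwoPins S κ ρ S₀ W γ n Θ hΘ I Sg π)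
    (hcls : ∀ (P : Fin n → ↥(Sprung2012.localTowerPointsOfEmb κ (closureEmb (K := ℚ) (π.v.adicCompletion ℚ)) W)) (k : ℕ),
      ∃ y : Dloc S κ ρ π.v, ∀ t : (Fin n → ↥(Sprung2012.localTowerPointsOfEmb κ (closureEmb (K := ℚ) (π.v.adicCompletion ℚ)) W)) →+ ℤ_[2],
        π₂.c₂ t y = (PadicInt.toZModPow k (t P)).val • ((((2 : ℚ) ^ k)⁻¹ : ℚ) : AddCircle (1 : ℚ))) :
    Function.Injective π₂.c₂ := by
  intro t t' h
  refine AddMonoidHom.ext fun P ↦ padicInt_eq_of_forall_levelValue_eq fun k ↦ ?_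
  obtain ⟨y, hval⟩ := hcls P k
  rw [← hval t, ← hval t', h]

/-- **PERF₂ (T1 (c)) REDUCED TO A COHERENT KUMMER-CLASS FAMILY** — the ALGEBRA of local Tate duality along the tower in the value currency.
Given additive `δ k : E(ℚ_{∞,v})ⁿ →+ D₂` (the level-`k` Kummer classes `P ↦ [τ ↦ Θ⁻¹(τQ − Q)]`, `2^k Q = P`) with `δ 0 = 0`,
`2·δ (k+1) = δ k`, EXHAUSTIVE (every class is some `δ k P` — Coates–Greenberg surjectivity of the Kummer map in the deeply ramified tower,
`H¹(ℚ_{∞,v}, E) [2^∞] = 0`) and VALUE-PINNED (`c₂ t (δ k P) = (t P mod 2^k)·2^{-k}`, = `AtTwoPins.hc₂` on the datum), `c₂` is ONTO: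
a character `χ` of `D₂` is read at level `k` as `f k : E(ℚ_{∞,v})ⁿ →+ ℤ/2^k` (`exists_zmodHom_of_nsmul_eq_zero` on the `2^k`-torsion group
`range (δ k)`), the `f k` are compatible (`2·δ (k+1) = δ k`), glue to `t := padicIntLift f ∈ 𝔉₂`, and `c₂ t = χ` on every `δ k P`.
[cite: MilneADT2006, Ch. I, Cor. 2.3] [cite: CoatesGreenberg1996, Prop. 4.3] [cite: PerrinRiou1994Invent, §3.6.1] -/
theorem c₂_surjective_of_kummerFamily (π₂ : AtTwoPins S κ ρ S₀ W γ n Θ hΘ I Sg π)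
    (δ : ℕ → ((Fin n → ↥(Sprung2012.localTowerPointsOfEmb κ (closureEmb (K := ℚ) (π.v.adicCompletion ℚ)) W)) →+ Dloc S κ ρ π.v))
    (hδ₀ : ∀ P, δ 0 P = 0) (hδs : ∀ k P, 2 • δ (k + 1) P = δ k P)
    (hδe : ∀ y : Dloc S κ ρ π.v, ∃ k P, δ k P = y)
    (hδv : ∀ (k : ℕ) (P) (t : (Fin n → ↥(Sprung2012.localTowerPointsOfEmb κ (closureEmb (K := ℚ) (π.v.adicCompletion ℚ)) W)) →+ ℤ_[2]),
      π₂.c₂ t (δ k P) = (PadicInt.toZModPow k (t P)).val • ((((2 : ℚ) ^ k)⁻¹ : ℚ) : AddCircle (1 : ℚ))) :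
    Function.Surjective π₂.c₂ := by
  intro χ
  -- (i) the level-`k` classes are `2^k`-torsion
  have htor : ∀ (k : ℕ) (P), (2 ^ k) • δ k P = 0 := by
    intro k
    induction k with
    | zero => intro P; rw [pow_zero, one_smul, hδ₀]
    | succ k ih => intro P; rw [pow_succ, mul_smul, hδs, ih]
  -- (ii) `χ ∘ δ k` reads as a `ℤ/2^k`-valued functional
  have hread : ∀ k : ℕ, ∃ fk : (Fin n → ↥(Sprung2012.localTowerPointsOfEmb κ (closureEmb (K := ℚ) (π.v.adicCompletion ℚ)) W)) →+ ZMod (2 ^ k),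
      ∀ P, χ (δ k P) = (fk P).val • ((((2 : ℚ) ^ k)⁻¹ : ℚ) : AddCircle (1 : ℚ)) := by
    intro k
    haveI : NeZero (2 ^ k) := ⟨pow_ne_zero k two_ne_zero⟩
    have hD : ∀ y : ↥(δ k).range, (2 ^ k) • y = 0 := by
      rintro ⟨y, hy⟩
      obtain ⟨P, rfl⟩ := AddMonoidHom.mem_range.1 hy
      exact Subtype.ext (htor k P)
    obtain ⟨f₀, hf₀⟩ := exists_zmodHom_of_nsmul_eq_zero hD (χ.comp (δ k).range.subtype)
    refine ⟨f₀.comp (δ k).rangeRestrict, fun P ↦ ?_⟩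
    have h := hf₀ ((δ k).rangeRestrict P)
    rw [inv_natCast_two_pow] at h
    exact h
  choose f hf using hread
  -- (iii) the readings are compatible
  have hcompat : ∀ (k : ℕ) (P), (ZMod.cast (f (k + 1) P) : ZMod (2 ^ k)) = f k P := by
    intro k P
    haveI : NeZero (2 ^ k) := ⟨pow_ne_zero k two_ne_zero⟩
    apply zmod_eq_of_val_smul_eq (N := 2 ^ k)
    rw [inv_natCast_two_pow, cast_val_smul_eq, ← hf (k + 1) P, ← hf k P, ← map_nsmul, hδs]
  -- (iv) the 2-adic limit `t` has `c₂ t = χ`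
  refine ⟨Literature.Algebra.InverseSystem.padicIntLift 2 f hcompat, DFunLike.ext _ _ fun y ↦ ?_⟩
  obtain ⟨k, P, rfl⟩ := hδe y
  rw [hδv, Literature.Algebra.InverseSystem.toZModPow_padicIntLift, hf]

end Pins

/-! ## §C The (⇐) direction of `hSg`: the `∀ σ` of RSL_g's clause (3) is a ONE-ORBIT statement -/

section Orbit

open Literature.NumberTheory.EllipticCurves Literature.NumberTheory.EllipticCurves.GreenbergSelmer
open Literature.NumberTheory.GaloisRepresentations NumberField IsDedekindDomain Field
open GreenbergSelmer Kobayashi2003 Literature.NumberTheory.EllipticCurves.CyclotomicLayer CategoryTheory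

/-- **Generic one-orbit reduction** (the pattern of `CokerAtTwo.forall_conjH1_mem_awayKer_iff` for an ARBITRARY predicate `C` on `H¹(H, M)`):
if `G = D·H` (`∀ σ, ∃ d ∈ D, d⁻¹σ ∈ H`) and `C` is transported by `conj_d`, `d ∈ D`, then «`C (conj_σ c)` for all `σ`» ⟺ «`C c`»
(`conj_h = id` for `h ∈ H`). [cite: SerreLocalFields1979, VII.§5 Prop. 3] [cite: Greenberg1989, §1 p. 98] -/
theorem forall_conjH1_iff_of_transport {G : Type u} [Group G] [TopologicalSpace G] [IsTopologicalGroup G]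
    (H : Subgroup G) [H.Normal] (M : Type u) [AddCommGroup M] [DistribMulAction G M] [TopologicalSpace M] [DiscreteTopology M]
    (D : Set G) (C : subgroupH1 H M → Prop)
    (hgen : ∀ σ : G, ∃ d ∈ D, d⁻¹ * σ ∈ H) (hD : ∀ d ∈ D, ∀ c, C c → C (conjH1 H M d c)) (c : subgroupH1 H M) :
    (∀ σ : G, C (conjH1 H M σ c)) ↔ C c := by
  refine ⟨fun h ↦ ?_, fun h σ ↦ ?_⟩
  · have h1 := h 1
    rwa [Literature.NumberTheory.EllipticCurves.conjH1_one_holds H M, AddMonoidHom.id_apply] at h1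
  · obtain ⟨d, hd, hh⟩ := hgen σ
    rw [show σ = d * (d⁻¹ * σ) by group, Literature.NumberTheory.EllipticCurves.conjH1_mul_holds H M, AddMonoidHom.comp_apply,
      Literature.NumberTheory.EllipticCurves.conjH1_of_mem_holds H M hh, AddMonoidHom.id_apply]
    exact hD d hd c h

variable (S : Set (PadicAlgCl 2)) (κ : ZpExtension ℚ 2) (ρ : FramedGaloisRep ℚ ↥(padicCoeffIntegers S) 2)
  (W : WeierstrassCurve ℚ) (n : ℕ)
  (Θ : ∀ v : HeightOneSpectrum (𝓞 ℚ), ((2 : ℕ) : 𝓞 ℚ) ∈ v.asIdeal → (Cofree ρ ↥(padicCoeffField S) ≃+ (Fin n → ↥(W.geomPrimaryTorsion 2))))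
  (v : HeightOneSpectrum (𝓞 ℚ)) (hv : ((2 : ℕ) : 𝓞 ℚ) ∈ v.asIdeal)

/-- **Clause (3) of RSL_g at `(v, hv)` for ONE class `c`** (verbatim): a global cocycle `φ` representing `c`, a tuple `Q ∈ E(ℚ_v)ⁿ` with
`2^k Q ∈ (⨆_m E⁺_m)ⁿ`, and the Θ-Kummer identity on `U_{∞,v}`.  RSL_g's clause (3) for `y` reads `∀ v hv σ, PlusClauseAt … v hv (conj_σ y)`.
[cite: Kobayashi2003, Def. 1.1 and (8.23) (p. 18)] -/
def PlusClauseAt (c : subgroupH1 κ.kerSubgroup (Cofree ρ ↥(padicCoeffField S))) : Prop :=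
  ∃ (φ : contOneCocycles (discreteTopRep ↥κ.kerSubgroup (Cofree ρ ↥(padicCoeffField S))))
    (Q : Fin n → localPoints W (v.adicCompletion ℚ)) (k : ℕ),
    oneCocycleClass (discreteTopRep ↥κ.kerSubgroup (Cofree ρ ↥(padicCoeffField S))) φ = c ∧
    (∀ i, (2 ^ k) • Q i ∈ ⨆ m : ℕ, signedLocalPoints κ (v.adicCompletion ℚ) W 1 m) ∧
    ∀ (τ : ↥(kerGroup κ v)) (i : Fin n), pointsMapOfEmb W (closureEmb (K := ℚ) (v.adicCompletion ℚ))
      (((Θ v hv (φ.1 (resGalSubgroupOfEmb κ.kerSubgroup (closureEmb (K := ℚ) (v.adicCompletion ℚ)) τ))) i :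
        ↥(W.geomPrimaryTorsion 2)) : W.geomPoints) = (τ : absoluteGaloisGroup (v.adicCompletion ℚ)) • Q i - Q i

/-- **TYPED TARGET (the ONE new helper of the (⇐) direction of `hSg`): `D_v`-transport of a plus Θ-Kummer datum.**  For
`dd ∈ Γ_{ℚ_v}` and a global cocycle `φ` with plus datum `(Q, k)` at `v`, the conjugate cocycle `conjCocycle (θ_v dd) φ` has the plus datum
`(dd • Q, k)`: the Kummer identity is the tower twin of `CofreeSelmerTransfer.thetaKummerWitness_conj` (uses `hΘ` and `conjCocycle_apply`),
and `2^k (dd • Q i) = dd • 2^k Q i ∈ ⨆_m E⁺_m` by the `Γ_v`-stability of every `E⁺_m` (`PTDeep.smul_mem_signedLocalPointsOfEmb`).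
A `Prop`, NOT proved here. [cite: Kobayashi2003, Def. 1.1] [cite: SerreGaloisCohomology1997, I §2.5] -/
def PlusTransport : Prop :=
  ∀ (dd : absoluteGaloisGroup (v.adicCompletion ℚ))
    (φ : contOneCocycles (discreteTopRep ↥κ.kerSubgroup (Cofree ρ ↥(padicCoeffField S))))
    (Q : Fin n → localPoints W (v.adicCompletion ℚ)) (k : ℕ),
    (∀ i, (2 ^ k) • Q i ∈ ⨆ m : ℕ, signedLocalPoints κ (v.adicCompletion ℚ) W 1 m) →
    (∀ (τ : ↥(kerGroup κ v)) (i : Fin n), pointsMapOfEmb W (closureEmb (K := ℚ) (v.adicCompletion ℚ))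
      (((Θ v hv (φ.1 (resGalSubgroupOfEmb κ.kerSubgroup (closureEmb (K := ℚ) (v.adicCompletion ℚ)) τ))) i :
        ↥(W.geomPrimaryTorsion 2)) : W.geomPoints) = (τ : absoluteGaloisGroup (v.adicCompletion ℚ)) • Q i - Q i) →
    (∀ i, (2 ^ k) • (dd • Q i) ∈ ⨆ m : ℕ, signedLocalPoints κ (v.adicCompletion ℚ) W 1 m) ∧
    ∀ (τ : ↥(kerGroup κ v)) (i : Fin n), pointsMapOfEmb W (closureEmb (K := ℚ) (v.adicCompletion ℚ))
      (((Θ v hv ((conjCocycle κ.kerSubgroup (resGalOfEmb (closureEmb (K := ℚ) (v.adicCompletion ℚ)) dd) φ).1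
        (resGalSubgroupOfEmb κ.kerSubgroup (closureEmb (K := ℚ) (v.adicCompletion ℚ)) τ))) i :
        ↥(W.geomPrimaryTorsion 2)) : W.geomPoints) = (τ : absoluteGaloisGroup (v.adicCompletion ℚ)) • (dd • Q i) - dd • Q i

variable {S κ ρ W n Θ v hv}

/-- **(⇐) OF `hSg`, THE `∀ σ` PART — PROVED from the typed target**: if `Γ_ℚ = θ_v(Γ_{ℚ_v})·Γ_∞` at `v` and `PlusTransport` holds, then
clause (3) of RSL_g at `v` for ALL conjugates `conj_σ y` is equivalent to clause (3) at `σ = 1` (representative `conjCocycle`, class by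
`conjH1_oneCocycleClass`). [cite: Greenberg1989, §1 p. 98] [cite: Kobayashi2003, Def. 1.1] -/
theorem forall_plusClauseAt_conjH1_iff
    (hgen : ∀ σ : absoluteGaloisGroup ℚ, ∃ dd : absoluteGaloisGroup (v.adicCompletion ℚ),
      (resGalOfEmb (closureEmb (K := ℚ) (v.adicCompletion ℚ)) dd)⁻¹ * σ ∈ κ.kerSubgroup)
    (htrans : PlusTransport S κ ρ W n Θ v hv) (y : subgroupH1 κ.kerSubgroup (Cofree ρ ↥(padicCoeffField S))) :
    (∀ σ : absoluteGaloisGroup ℚ, PlusClauseAt S κ ρ W n Θ v hv (conjH1 κ.kerSubgroup (Cofree ρ ↥(padicCoeffField S)) σ y)) ↔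
      PlusClauseAt S κ ρ W n Θ v hv y := by
  refine forall_conjH1_iff_of_transport κ.kerSubgroup (Cofree ρ ↥(padicCoeffField S))
    (Set.range (resGalOfEmb (closureEmb (K := ℚ) (v.adicCompletion ℚ)))) (PlusClauseAt S κ ρ W n Θ v hv)
    (fun σ ↦ (hgen σ).elim fun dd h ↦ ⟨_, ⟨dd, rfl⟩, h⟩) ?_ y
  rintro d ⟨dd, rfl⟩ c ⟨φ, Q, k, hφ, hplus, hK⟩
  obtain ⟨hplus', hK'⟩ := htrans dd φ Q k hplus hK
  exact ⟨conjCocycle κ.kerSubgroup (resGalOfEmb (closureEmb (K := ℚ) (v.adicCompletion ℚ)) dd) φ, fun i ↦ dd • Q i, k,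
    by rw [← hφ, conjH1_oneCocycleClass], hplus', hK'⟩

/-- **The instance at the place above `2`** (κ cyclotomic: `2` is totally ramified in `ℚ_∞`, so `Γ_ℚ = D_v·Γ_∞`,
`CokerAtTwo.exists_mem_decomp_inv_mul_mem_kerSubgroup_two`): the `∀ σ` of clause (3) at `v ∋ 2` collapses to `σ = 1` once `PlusTransport`
is proved. [cite: Washington1997, §13.1] [cite: Kobayashi2003, Def. 1.1] -/
theorem forall_plusClauseAt_conjH1_iff_two (hκ : κ.IsCyclotomic)
    (htrans : PlusTransport S κ ρ W n Θ v hv) (y : subgroupH1 κ.kerSubgroup (Cofree ρ ↥(padicCoeffField S))) :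
    (∀ σ : absoluteGaloisGroup ℚ, PlusClauseAt S κ ρ W n Θ v hv (conjH1 κ.kerSubgroup (Cofree ρ ↥(padicCoeffField S)) σ y)) ↔
      PlusClauseAt S κ ρ W n Θ v hv y := by
  refine forall_plusClauseAt_conjH1_iff (fun σ ↦ ?_) htrans y
  obtain ⟨d, ⟨dd, hdd⟩, hh⟩ :=
    Summit.BirchSwinnertonDyer.BirchSwinnertonDyer.Theorems.AlignedTransportAtTwoFineRoad.CokerAtTwo.exists_mem_decomp_inv_mul_mem_kerSubgroup_two
      κ hκ hv σ
  exact ⟨dd, by rw [← hdd] at hh; exact hh⟩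

/-- **Uniqueness of the place above `2`** (so the `∀ v hv` of clause (3) is the single place `π.v`), by name from the tree. [folklore] -/
theorem eq_of_two_mem {v w : HeightOneSpectrum (𝓞 ℚ)} (hv : ((2 : ℕ) : 𝓞 ℚ) ∈ v.asIdeal) (hw : ((2 : ℕ) : 𝓞 ℚ) ∈ w.asIdeal) :
    v = w :=
  WeierstrassCurve.Rat.heightOneSpectrum_eq_of_two_mem (by simpa using hv) (by simpa using hw)

end Orbit

end Summit.BirchSwinnertonDyer.BirchSwinnertonDyer.Cruxes.ResidualThetaCountLowerPureAtTwo.SideaK1G19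

end
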